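import Summits.Ventures.HSemireg.Pad4TowerLineDesignCert12Closure

/-!
# Pad4Tower ∕ LineDesignCert12 — KERNEL DECIDES (2∕7, `RuleD2`): RULE D (μ₄, M) at the `N`-heads of chunks 38–61 of 61; RULE D (μ₄, M) at the `P`-heads of chunks 1–12 of 47

Tree cut of the KERNEL CERTIFICATE `Cert12`: the `decide +kernel` theorems of this module are, by NAME, STATEMENT and PROOF, those of the farm-certified
Cruxes-level parts `CeilingLineCert12A–E` (split5); the module boundary is set by the gate's build budget only. Each theorem is one static-family check at a few
heads of the design `cfg` of `Pad4TowerLineDesignCert12Closure`; the assembly is in `Pad4TowerLineDesignCert12`.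

MODULE SET (tree cut of ONE certificate; one namespace `Summit.Ventures.HSemireg.Pad4Tower.LineDesignCert12`): `…Cert12DataN` ∕ `DataP` ∕ `DataPd` ∕ `DataNd` (the support and its literal
dual-0 world, DATA ONLY) → `…Cert12Closure` (key-chain `Nodup`, the design `cfg`, the literal dual `cfgd` and `cfg_dual_eq`, ◇₁₂, the ceiling line, per-chunk
G₁ closure ⇒ `cfg` is Δ- and S₄-closed) → `…Cert12RuleD1` ∕ `…Cert12RuleD2` ∕ `…Cert12RuleD3` ∕ `…Cert12XPlus1` ∕ `…Cert12XPlus2` ∕ `…Cert12XPlus3` ∕ `…Cert12XPlus4` (the RULE D (μ₄, M) resp. guarded X⁺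
decides, a few heads per theorem, module boundaries set by the gate's build budget only) → `Pad4TowerLineDesignCert12` (assembly `cfg_staticH1` and the
UNCONDITIONAL doors `¬ SeedB1OddDiamondG1H1 12`, `¬ SeedB1OddConeG1H1`, `¬ SeedB1OddDiamondG1H1 h'` (12 ≤ h'), the LINE shape, every support cell's realisability).

NOTHING IN THIS MODULE SET SAYS THAT HC ∕ HC_CM ∕ HC_AV ∕ H2 ∕ stmt-HodgeConjecture-18881 HOLDS OR FAILS (HC_CM is a displayed binder of the
ladder only); the certified statements concern the typed FIRST-ORDER static game (`RuleDMu4Closed`, `XPlusClosed`, `A2IMinusClosed` = `MConfig.StaticH1`)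
of ONE explicit finite support — first order is necessary, not sufficient, for a seed; no σ, no seed, no census row. `decide +kernel` only: NO `native_decide`,
no `sorry`, no `axiom`, no `instance`, no notation, no Literature fact, no new `def … : Prop`.
-/

set_option linter.dupNamespace false

namespace Summit.Ventures.HSemireg.Pad4Tower.LineDesignCert12

open Summit.Ventures.HSemireg Summit.Ventures.HSemireg.Pad4Tower

set_option maxRecDepth 32768
set_option Elab.async false
set_option synthInstance.maxSize 8192
set_option synthInstance.maxHeartbeats 2000000
set_option maxHeartbeats 8000000

/-! RULE D (μ₄, M) at the `N`-cells, heads chunked (5 per theorem) -/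

/-- RULE D (μ₄, M) holds at the `N`-heads of chunk 38∕61. [kernel `decide`] -/
theorem ruleDN_38 : ∀ Z ∈ lN_38, RuleDMu4N cfg Z := by decide +kernel
/-- RULE D (μ₄, M) holds at the `N`-heads of chunk 39∕61. [kernel `decide`] -/
theorem ruleDN_39 : ∀ Z ∈ lN_39, RuleDMu4N cfg Z := by decide +kernel
/-- RULE D (μ₄, M) holds at the `N`-heads of chunk 40∕61. [kernel `decide`] -/
theorem ruleDN_40 : ∀ Z ∈ lN_40, RuleDMu4N cfg Z := by decide +kernel
/-- RULE D (μ₄, M) holds at the `N`-heads of chunk 41∕61. [kernel `decide`] -/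
theorem ruleDN_41 : ∀ Z ∈ lN_41, RuleDMu4N cfg Z := by decide +kernel
/-- RULE D (μ₄, M) holds at the `N`-heads of chunk 42∕61. [kernel `decide`] -/
theorem ruleDN_42 : ∀ Z ∈ lN_42, RuleDMu4N cfg Z := by decide +kernel
/-- RULE D (μ₄, M) holds at the `N`-heads of chunk 43∕61. [kernel `decide`] -/
theorem ruleDN_43 : ∀ Z ∈ lN_43, RuleDMu4N cfg Z := by decide +kernel
/-- RULE D (μ₄, M) holds at the `N`-heads of chunk 44∕61. [kernel `decide`] -/
theorem ruleDN_44 : ∀ Z ∈ lN_44, RuleDMu4N cfg Z := by decide +kernel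
/-- RULE D (μ₄, M) holds at the `N`-heads of chunk 45∕61. [kernel `decide`] -/
theorem ruleDN_45 : ∀ Z ∈ lN_45, RuleDMu4N cfg Z := by decide +kernel
/-- RULE D (μ₄, M) holds at the `N`-heads of chunk 46∕61. [kernel `decide`] -/
theorem ruleDN_46 : ∀ Z ∈ lN_46, RuleDMu4N cfg Z := by decide +kernel
/-- RULE D (μ₄, M) holds at the `N`-heads of chunk 47∕61. [kernel `decide`] -/
theorem ruleDN_47 : ∀ Z ∈ lN_47, RuleDMu4N cfg Z := by decide +kernel
/-- RULE D (μ₄, M) holds at the `N`-heads of chunk 48∕61. [kernel `decide`] -/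
theorem ruleDN_48 : ∀ Z ∈ lN_48, RuleDMu4N cfg Z := by decide +kernel
/-- RULE D (μ₄, M) holds at the `N`-heads of chunk 49∕61. [kernel `decide`] -/
theorem ruleDN_49 : ∀ Z ∈ lN_49, RuleDMu4N cfg Z := by decide +kernel
/-- RULE D (μ₄, M) holds at the `N`-heads of chunk 50∕61. [kernel `decide`] -/
theorem ruleDN_50 : ∀ Z ∈ lN_50, RuleDMu4N cfg Z := by decide +kernel
/-- RULE D (μ₄, M) holds at the `N`-heads of chunk 51∕61. [kernel `decide`] -/
theorem ruleDN_51 : ∀ Z ∈ lN_51, RuleDMu4N cfg Z := by decide +kernel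
/-- RULE D (μ₄, M) holds at the `N`-heads of chunk 52∕61. [kernel `decide`] -/
theorem ruleDN_52 : ∀ Z ∈ lN_52, RuleDMu4N cfg Z := by decide +kernel
/-- RULE D (μ₄, M) holds at the `N`-heads of chunk 53∕61. [kernel `decide`] -/
theorem ruleDN_53 : ∀ Z ∈ lN_53, RuleDMu4N cfg Z := by decide +kernel
/-- RULE D (μ₄, M) holds at the `N`-heads of chunk 54∕61. [kernel `decide`] -/
theorem ruleDN_54 : ∀ Z ∈ lN_54, RuleDMu4N cfg Z := by decide +kernel
/-- RULE D (μ₄, M) holds at the `N`-heads of chunk 55∕61. [kernel `decide`] -/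
theorem ruleDN_55 : ∀ Z ∈ lN_55, RuleDMu4N cfg Z := by decide +kernel
/-- RULE D (μ₄, M) holds at the `N`-heads of chunk 56∕61. [kernel `decide`] -/
theorem ruleDN_56 : ∀ Z ∈ lN_56, RuleDMu4N cfg Z := by decide +kernel
/-- RULE D (μ₄, M) holds at the `N`-heads of chunk 57∕61. [kernel `decide`] -/
theorem ruleDN_57 : ∀ Z ∈ lN_57, RuleDMu4N cfg Z := by decide +kernel
/-- RULE D (μ₄, M) holds at the `N`-heads of chunk 58∕61. [kernel `decide`] -/
theorem ruleDN_58 : ∀ Z ∈ lN_58, RuleDMu4N cfg Z := by decide +kernel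
/-- RULE D (μ₄, M) holds at the `N`-heads of chunk 59∕61. [kernel `decide`] -/
theorem ruleDN_59 : ∀ Z ∈ lN_59, RuleDMu4N cfg Z := by decide +kernel
/-- RULE D (μ₄, M) holds at the `N`-heads of chunk 60∕61. [kernel `decide`] -/
theorem ruleDN_60 : ∀ Z ∈ lN_60, RuleDMu4N cfg Z := by decide +kernel
/-- RULE D (μ₄, M) holds at the `N`-heads of chunk 61∕61. [kernel `decide`] -/
theorem ruleDN_61 : ∀ Z ∈ lN_61, RuleDMu4N cfg Z := by decide +kernel

/-! RULE D (μ₄, M) at the `P`-cells, heads chunked (10 per theorem) -/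

/-- RULE D (μ₄, M) holds at the `P`-heads of chunk 1∕47. [kernel `decide`] -/
theorem ruleDP_1 : ∀ P ∈ lP_1, RuleDMu4P cfg P := by decide +kernel
/-- RULE D (μ₄, M) holds at the `P`-heads of chunk 2∕47. [kernel `decide`] -/
theorem ruleDP_2 : ∀ P ∈ lP_2, RuleDMu4P cfg P := by decide +kernel
/-- RULE D (μ₄, M) holds at the `P`-heads of chunk 3∕47. [kernel `decide`] -/
theorem ruleDP_3 : ∀ P ∈ lP_3, RuleDMu4P cfg P := by decide +kernel
/-- RULE D (μ₄, M) holds at the `P`-heads of chunk 4∕47. [kernel `decide`] -/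
theorem ruleDP_4 : ∀ P ∈ lP_4, RuleDMu4P cfg P := by decide +kernel
/-- RULE D (μ₄, M) holds at the `P`-heads of chunk 5∕47. [kernel `decide`] -/
theorem ruleDP_5 : ∀ P ∈ lP_5, RuleDMu4P cfg P := by decide +kernel
/-- RULE D (μ₄, M) holds at the `P`-heads of chunk 6∕47. [kernel `decide`] -/
theorem ruleDP_6 : ∀ P ∈ lP_6, RuleDMu4P cfg P := by decide +kernel
/-- RULE D (μ₄, M) holds at the `P`-heads of chunk 7∕47. [kernel `decide`] -/
theorem ruleDP_7 : ∀ P ∈ lP_7, RuleDMu4P cfg P := by decide +kernel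
/-- RULE D (μ₄, M) holds at the `P`-heads of chunk 8∕47. [kernel `decide`] -/
theorem ruleDP_8 : ∀ P ∈ lP_8, RuleDMu4P cfg P := by decide +kernel
/-- RULE D (μ₄, M) holds at the `P`-heads of chunk 9∕47. [kernel `decide`] -/
theorem ruleDP_9 : ∀ P ∈ lP_9, RuleDMu4P cfg P := by decide +kernel
/-- RULE D (μ₄, M) holds at the `P`-heads of chunk 10∕47. [kernel `decide`] -/
theorem ruleDP_10 : ∀ P ∈ lP_10, RuleDMu4P cfg P := by decide +kernel
/-- RULE D (μ₄, M) holds at the `P`-heads of chunk 11∕47. [kernel `decide`] -/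
theorem ruleDP_11 : ∀ P ∈ lP_11, RuleDMu4P cfg P := by decide +kernel
/-- RULE D (μ₄, M) holds at the `P`-heads of chunk 12∕47. [kernel `decide`] -/
theorem ruleDP_12 : ∀ P ∈ lP_12, RuleDMu4P cfg P := by decide +kernel


end Summit.Ventures.HSemireg.Pad4Tower.LineDesignCert12
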